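import Mathlib.Analysis.Complex.Trigonometric
import Mathlib.Analysis.SpecialFunctions.Trigonometric.Bounds
import Literature.Geometry.DiscreteGeometry.SphericalExcessMonotone
import Literature.Geometry.DiscreteGeometry.KissingCornerBounds
import HarnessLib

/-!
# The main estimate for kissing configurations, per Delaunay triangle
# (Hales 2012, Theorem 2, inequality `A ≥ sol₀ + d₃(r,s,t)` [HFBBNUL]) — proved

Topic `Literature/Geometry/DiscreteGeometry`; provefact brick for the named fact
`Hales2012_contactGraphTame` (`TameContactGraphs.lean`: Hales's Theorem 3 with Lemma 8), whose
printed proof rests on the *main estimate*, Theorem 2.  The heart of Theorem 2 is a table of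
lower bounds for the solid angle `A` of the cone over a Delaunay triangle `{u₁, u₂, u₃}` of a
twelve-point packing `V ⊂ S²(2)` in terms of the number `r` of contact edges (length `2`) and
the numbers `s`, `t` of longer edges (length `≥ 2h₀ = 2.52`, split at `3.0`):

> "We claim that the solid angle `A = sol(0, aff⁰₊(0, {u₁, u₂, u₃}))` satisfies
> `A ≥ sol₀ + d₃(r, s, t)` … To show this, we work case by case in the parameters `(r, s, t)` …
> we use Lexell's theorem to calculate bounds on the area of the Delaunay triangle, given the
> ranges on edges … By a simple calculation [HFBBNUL: This was done in Mathematica] the other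
> cases have been checked in a similar way." (arXiv:1209.6043, proof of Theorem 2, pp. 6–7),

with `sol₀ = 3 arccos (1/3) − π ≈ 0.5513` ("the solid angle of a spherical equilateral triangle
with a side of arclength `π/3`", §4) and `d₃(r,s,t) = 0.103 (2 − s) + 0.27 (r + 2s + 2t − 4)`
except `d₃(3,0,0) = d₃(2,0,1) = 0`.  This file PROVES such bounds in Lean, by Euler's formula
`1 − cos A = D/((1+x)(1+y)(1+z))` and the corner principle of `SphericalExcessMonotone.lean`
(Lexell in algebraic form) instead of Mathematica.  Normalisation: the sphere is scaled to the
UNIT sphere (`u ↦ u/2`), so a triangle is a linearly independent triple of unit vectors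
`a, b, c ∈ ℝ³`, a contact edge is `⟪a, b⟫ = 1/2` (distance `1`, i.e. `2` on `S²(2)`), a long edge
is `⟪a, b⟫ ≤ κ₀ = 1 − h₀²/2 = 1031/5000` (distance `≥ h₀ = 1.26`, i.e. `≥ 2h₀` on `S²(2)`;
`hales_kappa0_eq`), and every edge of a Delaunay triangle has `⟪a, b⟫ ≥ −1/2` (length `< 2√3`
on `S²(2)`: `dist_lt_two_sqrt_three_of_twelve`, `KissingSaturationKissingNumber.lean`);
`A = sphExcess a b c` (`= 4π · solidAngleFraction`, Girard).

## What is proved (all for linearly independent unit `a b c : ℝ³`; `E = sphExcess a b c`)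

* `hales_sol0 = 3 arccos (1/3) − π = arccos (23/27)`, `cos sol₀ = 23/27`,
  `sin sol₀ = √(200/729)`, and `sphExcess_eq_sol0_of_contact`: **`(3,0,0)`: `E = sol₀`**
  (sharp, as printed).
* `sol0_le_sphExcess_of_isosceles`: **`(2,·,·)`: `E ≥ sol₀`** when the third edge has
  `−1/3 ≤ ⟪b, c⟫ ≤ 1/2` — the printed sharp case `(2,0,1)` ("the circumradius-derived upper
  bound on the long edge is `√(32/3)`, the solid angle is at least `sol₀`"; squared length
  `≤ 32/3` on `S²(2)` is `⟪b, c⟫ ≥ −1/3` here), with equality at both ends.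
* `sol0_add_le_sphExcess_of_isosceles_short`: **`(2,1,0)`: `E ≥ sol₀ + 0.103`** when the
  third edge has length in `[2h₀, 3.0]` on `S²(2)` (`−1/8 ≤ ⟪b, c⟫ ≤ κ₀`).
* `sol0_add_le_sphExcess_of_one_contact`: **`(1,·,·)`: `E ≥ sol₀ + 0.27`** when the two
  other edges are long (`⟪·,·⟫ ∈ [−1/2, κ₀]`) — the printed `d₃(1,2,0) = 0.27`, valid for all
  `(1, s, t)`; and `…_of_one_contact_of_nonpos`: `E ≥ sol₀ + 0.36` if one of them has moreover
  `⟪·,·⟫ ≤ 0` (length `≥ 2√2` on `S²(2)`).  (Hales's finer `d₃(1,1,1) = 0.373`,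
  `d₃(1,0,2) = 0.476` use the circumradius constraint, not only edge ranges; not needed here.)
* `sol0_add_le_sphExcess_of_no_contact`: **`(0,·,·)`: `E ≥ sol₀ + 0.5`** when all three edges
  are long and `⟪b,c⟫ + ⟪a,c⟫ + ⟪a,b⟫ > −3/4` (`> −3/8` holds on every Delaunay triangle by
  `sum_inner_ge_of_common_cap`: the three vertices lie on a cap of angular radius `< π/3`) —
  better than the printed `d₃(0,3,0) = 0.437`; and `…_of_no_contact_of_nonpos`:
  `E ≥ sol₀ + 0.63` if one edge has moreover `⟪·,·⟫ ≤ 0`.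
* The numerical lemma behind the constants, `one_sub_cos_sol0_add_le`:
  `1 − cos (sol₀ + d) ≤ 1 − (23/27)(1 − d²/2) + (14143/27000)(d − d³/6 + d⁵/100)` on `[0, 1]`
  (`cos d ≥ 1 − d²/2`, Mathlib's `sin_bound`, `√200/27 < 14143/27000`), so that every case is
  "rational lower bound at the corners of a box of side-cosines" (`le_eulerF_of_corners₂/₃`)
  plus `norm_num`.

Everything is PROVED; no named facts.  Not here: the passage from these per-triangle bounds to
faces of the contact graph (superadditivity of `d₃`, Lemmas 4–6) and the census of Theorem 3.

## References
* T. C. Hales, *A proof of Fejes Tóth's conjecture on sphere packings with kissing number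
  twelve*, arXiv:1209.6043 (2012): §4, Theorem 2 and its proof (the function `d₃`, inequality
  `A ≥ sol₀ + d₃(r,s,t)`, calculation [HFBBNUL]), Remark 1 (Lexell). [`Hales2012`]
-/

noncomputable section

namespace Literature.Geometry.DiscreteGeometry

open Real RealInnerProductSpace InnerProductGeometry

/-! ### Part A. The constants `sol₀`, `κ₀` and the numerical lemma -/

/-- **`sol₀ = 3 arccos (1/3) − π ≈ 0.5513`**, "the solid angle of a spherical equilateral
triangle with a side of arclength `π/3`" (the weight unit of Hales's main estimate).
[cite: Hales2012, §4 (eqn. τ(V,E,F) = sol(U_F) + (2 − k(F)) sol₀)] -/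
def hales_sol0 : ℝ := 3 * arccos (1 / 3) - π

/-- Unfolding `hales_sol0`. [cite: Hales2012, §4] -/
theorem hales_sol0_def : hales_sol0 = 3 * arccos (1 / 3) - π := rfl

/-- `sol₀ = arccos (23/27)`. [folklore] -/
theorem hales_sol0_eq_arccos : hales_sol0 = arccos (23 / 27) := by
  have h := three_mul_arccos_third
  unfold hales_sol0
  linarith

/-- `cos sol₀ = 23/27`. [folklore] -/
theorem cos_hales_sol0 : cos hales_sol0 = 23 / 27 := by
  rw [hales_sol0_eq_arccos, cos_arccos (by norm_num) (by norm_num)]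

/-- `sin sol₀ = √(1 − (23/27)²)` (`= 10√2/27`). [folklore] -/
theorem sin_hales_sol0 : sin hales_sol0 = Real.sqrt (1 - (23 / 27) ^ 2) := by
  rw [hales_sol0_eq_arccos, sin_arccos]

/-- `0 < sol₀`. [folklore] -/
theorem hales_sol0_pos : 0 < hales_sol0 := by
  rw [hales_sol0_eq_arccos]
  exact arccos_pos.2 (by norm_num)

/-- `sol₀ ≤ π/2`. [folklore] -/
theorem hales_sol0_le_pi_div_two : hales_sol0 ≤ π / 2 := by
  rw [hales_sol0_eq_arccos]
  exact arccos_le_pi_div_two.2 (by norm_num)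

/-- **`κ₀ = 1 − h₀²/2 = 1031/5000 = 0.2062`**: on the unit sphere, two points at distance
`≥ h₀ = 1.26` (i.e. `≥ 2h₀` on `S²(2)`, the separation of Hales's class `𝒱`) have inner product
`≤ κ₀`. [cite: Hales2012, Definition 1] -/
theorem hales_kappa0_eq : 1 - hales_h0 ^ 2 / 2 = 1031 / 5000 := by
  rw [hales_h0_eq]; norm_num

/-- **The numerical lemma**: for `0 ≤ d ≤ 1`,
`1 − cos (sol₀ + d) ≤ 1 − (23/27)(1 − d²/2) + (14143/27000)(d − d³/6 + d⁵/100)`, from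
`cos (sol₀ + d) = (23/27) cos d − √(200/729) sin d`, `cos d ≥ 1 − d²/2`,
`sin d ≤ d − d³/6 + d⁵/100` (Mathlib's `sin_bound`) and `√(200/729) ≤ 14143/27000`.
[folklore] -/
theorem one_sub_cos_sol0_add_le {d : ℝ} (h0 : 0 ≤ d) (h1 : d ≤ 1) :
    1 - cos (hales_sol0 + d) ≤
      1 - 23 / 27 * (1 - d ^ 2 / 2) + 14143 / 27000 * (d - d ^ 3 / 6 + d ^ 5 / 100) := by
  rw [cos_add, cos_hales_sol0, sin_hales_sol0]
  have hc : 1 - d ^ 2 / 2 ≤ cos d := one_sub_sq_div_two_le_cos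
  have hs : sin d ≤ d - d ^ 3 / 6 + d ^ 5 / 100 := by
    have hb := Real.sin_bound (show |d| ≤ 1 by rwa [abs_of_nonneg h0])
    rw [abs_of_nonneg h0] at hb
    linarith [(abs_le.1 hb).2]
  have hs0 : 0 ≤ sin d := sin_nonneg_of_nonneg_of_le_pi h0 (by linarith [pi_gt_three])
  have hsq : Real.sqrt (1 - (23 / 27) ^ 2) ≤ 14143 / 27000 := by
    rw [Real.sqrt_le_left (by norm_num)]
    norm_num
  have e1 : Real.sqrt (1 - (23 / 27) ^ 2) * sin d ≤ 14143 / 27000 * sin d :=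
    mul_le_mul_of_nonneg_right hsq hs0
  have e2 : (14143 / 27000 : ℝ) * sin d ≤ 14143 / 27000 * (d - d ^ 3 / 6 + d ^ 5 / 100) :=
    mul_le_mul_of_nonneg_left hs (by norm_num)
  nlinarith

/-! ### Part B. The estimates -/

section Estimates

local notation "E3" => EuclideanSpace ℝ (Fin 3)

variable {a b c : E3}

/-- **Case `(3,0,0)`: a contact triangle has solid angle exactly `sol₀`** ("the estimate is
sharp in this case"). [cite: Hales2012, Theorem 2 (proof, case (r,s,t) = (3,0,0))] -/
theorem sphExcess_eq_sol0_of_contact (ha : ‖a‖ = 1) (hb : ‖b‖ = 1) (hc : ‖c‖ = 1)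
    (hab : ⟪a, b⟫ = 1 / 2) (hac : ⟪a, c⟫ = 1 / 2) (hbc : ⟪b, c⟫ = 1 / 2) :
    sphExcess a b c = hales_sol0 :=
  sphExcess_of_inner_eq_half ha hb hc hab hac hbc

/-- **Case `(2,·,·)`: an isosceles contact triangle (two edges of length `2` on `S²(2)`) whose
third edge has squared length `≤ 32/3` — i.e. `⟪b, c⟫ ≥ −1/3` on the unit sphere — has solid
angle `≥ sol₀`**, with equality at `⟪b, c⟫ = 1/2` (equilateral) and at `⟪b, c⟫ = −1/3` (apex
angle `2 arccos (1/3)`).  This is the printed sharp case `(2,0,1)`: "the circumradius-derived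
upper bound on the long edge is `√(32/3)`, the solid angle is at least `sol₀`".  Algebra:
`F(x, ½, ½) − 4/27 = 2(1+3x)(1−2x)/(27(1+x))`.
[cite: Hales2012, Theorem 2 (proof, case (r,s,t) = (2,0,1))] -/
theorem sol0_le_sphExcess_of_isosceles (ha : ‖a‖ = 1) (hb : ‖b‖ = 1) (hc : ‖c‖ = 1)
    (hli : LinearIndependent ℝ ![a, b, c]) (hab : ⟪a, b⟫ = 1 / 2) (hac : ⟪a, c⟫ = 1 / 2)
    (h₁ : -1 / 3 ≤ ⟪b, c⟫) (h₂ : ⟪b, c⟫ ≤ 1 / 2) : hales_sol0 ≤ sphExcess a b c := by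
  apply le_sphExcess_of_one_sub_cos_le ha hb hc hli
    (hales_sol0_le_pi_div_two.trans (by linarith [pi_pos]))
  rw [cos_hales_sol0, hac, hab]
  set x := ⟪b, c⟫ with hx
  have hpos : 0 < (1 + x) * (1 + 1 / 2) * (1 + 1 / 2) := by nlinarith
  rw [eulerF, eulerGram, le_div_iff₀ hpos]
  nlinarith [mul_nonneg (show (0 : ℝ) ≤ 1 + 3 * x by linarith) (show (0 : ℝ) ≤ 1 - 2 * x by
    linarith)]

/-- **Case `(2,1,0)`: `E ≥ sol₀ + 0.103`** for an isosceles contact triangle whose third edge has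
length in `[2h₀, 3.0]` on `S²(2)`, i.e. `−1/8 ≤ ⟪b, c⟫ ≤ κ₀ = 1031/5000` on the unit sphere.
By the endpoint principle the minimum of `F(x, ½, ½)` on `[−1/8, κ₀]` is
`min (3/14, F(κ₀,½,½)) = F(κ₀,½,½) = 1557171/7538750 ≈ 0.20656 ≥ 1 − cos (sol₀ + 0.103)`.
[cite: Hales2012, Theorem 2 (d₃(2,1,0) = 0.103)] -/
theorem sol0_add_le_sphExcess_of_isosceles_short (ha : ‖a‖ = 1) (hb : ‖b‖ = 1) (hc : ‖c‖ = 1)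
    (hli : LinearIndependent ℝ ![a, b, c]) (hab : ⟪a, b⟫ = 1 / 2) (hac : ⟪a, c⟫ = 1 / 2)
    (h₁ : -1 / 8 ≤ ⟪b, c⟫) (h₂ : ⟪b, c⟫ ≤ 1031 / 5000) :
    hales_sol0 + 0.103 ≤ sphExcess a b c := by
  apply le_sphExcess_of_one_sub_cos_le ha hb hc hli
    (by linarith [hales_sol0_le_pi_div_two, pi_gt_three])
  rw [hac, hab]
  have hm := min_eulerF_le₁ (x := ⟪b, c⟫) (y := 1 / 2) (z := 1 / 2) (x₁ := -1 / 8)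
    (x₂ := 1031 / 5000) (by norm_num) (by norm_num) (by norm_num) h₁ h₂
  have e1 : eulerF (-1 / 8) (1 / 2) (1 / 2) = 3 / 14 := by norm_num [eulerF, eulerGram]
  have e2 : eulerF (1031 / 5000) (1 / 2) (1 / 2) = 1557171 / 7538750 := by
    norm_num [eulerF, eulerGram]
  rw [e1, e2, min_eq_right (by norm_num)] at hm
  have hb := one_sub_cos_sol0_add_le (d := 0.103) (by norm_num) (by norm_num)
  refine le_trans hb (le_trans ?_ hm)
  norm_num

/-- **Case `(1,·,·)`: `E ≥ sol₀ + 0.27`** for a triangle with one contact edge `⟪a, b⟫ = 1/2`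
and two long edges (`⟪a, c⟫, ⟪b, c⟫ ∈ [−1/2, κ₀]`): the printed `d₃(1,2,0) = 0.27`, here for
all `(1, s, t)` from the edge ranges alone.  Corner principle on the box `[−1/2, κ₀]²`: the
least corner value is `F(κ₀, κ₀, ½) ≈ 0.3242 ≥ 0.322 ≥ 1 − cos (sol₀ + 0.27)`.
[cite: Hales2012, Theorem 2 (d₃(1,2,0) = 0.27)] -/
theorem sol0_add_le_sphExcess_of_one_contact (ha : ‖a‖ = 1) (hb : ‖b‖ = 1) (hc : ‖c‖ = 1)
    (hli : LinearIndependent ℝ ![a, b, c]) (hab : ⟪a, b⟫ = 1 / 2)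
    (hac : -1 / 2 ≤ ⟪a, c⟫ ∧ ⟪a, c⟫ ≤ 1031 / 5000) (hbc : -1 / 2 ≤ ⟪b, c⟫ ∧ ⟪b, c⟫ ≤ 1031 / 5000) :
    hales_sol0 + 0.27 ≤ sphExcess a b c := by
  apply le_sphExcess_of_one_sub_cos_le ha hb hc hli
    (by linarith [hales_sol0_le_pi_div_two, pi_gt_three])
  rw [hab]
  have hb := one_sub_cos_sol0_add_le (d := 0.27) (by norm_num) (by norm_num)
  refine le_trans hb (le_trans (show _ ≤ (161 / 500 : ℝ) by norm_num) ?_)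
  refine le_eulerF_of_corners₂ (by norm_num) (by norm_num) (by norm_num) hbc hac ?_
  intro x' hx' y' hy'
  simp only [Set.mem_insert_iff, Set.mem_singleton_iff] at hx' hy'
  rcases hx' with rfl | rfl <;> rcases hy' with rfl | rfl <;> norm_num [eulerF, eulerGram]

/-- **Case `(1,·,·)` with a very long edge: `E ≥ sol₀ + 0.36`** if in addition `⟪b, c⟫ ≤ 0`
(length `≥ 2√2` on `S²(2)`).  Corner principle on `[−1/2, 0] × [−1/2, κ₀]`: least corner value
`F(0, κ₀, ½) ≈ 0.3910 ≥ 0.389 ≥ 1 − cos (sol₀ + 0.36)`.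
[cite: Hales2012, Theorem 2 (proof, cases (1,s,t))] -/
theorem sol0_add_le_sphExcess_of_one_contact_of_nonpos (ha : ‖a‖ = 1) (hb : ‖b‖ = 1)
    (hc : ‖c‖ = 1) (hli : LinearIndependent ℝ ![a, b, c]) (hab : ⟪a, b⟫ = 1 / 2)
    (hac : -1 / 2 ≤ ⟪a, c⟫ ∧ ⟪a, c⟫ ≤ 1031 / 5000) (hbc : -1 / 2 ≤ ⟪b, c⟫ ∧ ⟪b, c⟫ ≤ 0) :
    hales_sol0 + 0.36 ≤ sphExcess a b c := by
  apply le_sphExcess_of_one_sub_cos_le ha hb hc hli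
    (by linarith [hales_sol0_le_pi_div_two, pi_gt_three])
  rw [hab]
  have hb := one_sub_cos_sol0_add_le (d := 0.36) (by norm_num) (by norm_num)
  refine le_trans hb (le_trans (show _ ≤ (389 / 1000 : ℝ) by norm_num) ?_)
  refine le_eulerF_of_corners₂ (by norm_num) (by norm_num) (by norm_num) hbc hac ?_
  intro x' hx' y' hy'
  simp only [Set.mem_insert_iff, Set.mem_singleton_iff] at hx' hy'
  rcases hx' with rfl | rfl <;> rcases hy' with rfl | rfl <;> norm_num [eulerF, eulerGram]

/-- **Three unit vectors on a common cap have a large sum of inner products.**  If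
`⟪n, a⟫ = ⟪n, b⟫ = ⟪n, c⟫ = t` for a unit vector `n` (the vertices of a Delaunay triangle lie on
the circle cut out by its facet plane), then `⟪b,c⟫ + ⟪a,c⟫ + ⟪a,b⟫ ≥ (9t² − 3)/2` — from
`‖a + b + c − 3t n‖² ≥ 0`.  For the Delaunay triangles of a twelve-point packing `t > 1/2`
(cap of angular radius `< π/3`: `one_lt_of_supporting_of_twelve`), so the sum is `> −3/8`.
[folklore] -/
theorem sum_inner_ge_of_common_cap {n : E3} (hn : ‖n‖ = 1) (ha : ‖a‖ = 1) (hb : ‖b‖ = 1)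
    (hc : ‖c‖ = 1) {t : ℝ} (hta : ⟪n, a⟫ = t) (htb : ⟪n, b⟫ = t) (htc : ⟪n, c⟫ = t) :
    (9 * t ^ 2 - 3) / 2 ≤ ⟪b, c⟫ + ⟪a, c⟫ + ⟪a, b⟫ := by
  have h0 : 0 ≤ ‖a + b + c - (3 * t) • n‖ ^ 2 := sq_nonneg _
  rw [← real_inner_self_eq_norm_sq] at h0
  have hnn : ⟪n, n⟫ = 1 := by rw [real_inner_self_eq_norm_sq, hn, one_pow]
  have haa : ⟪a, a⟫ = 1 := by rw [real_inner_self_eq_norm_sq, ha, one_pow]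
  have hbb : ⟪b, b⟫ = 1 := by rw [real_inner_self_eq_norm_sq, hb, one_pow]
  have hcc : ⟪c, c⟫ = 1 := by rw [real_inner_self_eq_norm_sq, hc, one_pow]
  have han : ⟪a, n⟫ = t := by rw [real_inner_comm]; exact hta
  have hbn : ⟪b, n⟫ = t := by rw [real_inner_comm]; exact htb
  have hcn : ⟪c, n⟫ = t := by rw [real_inner_comm]; exact htc
  simp only [inner_sub_left, inner_sub_right, inner_add_left, inner_add_right,
    real_inner_smul_left, real_inner_smul_right, hnn, haa, hbb, hcc, han, hbn, hcn, hta, htb,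
    htc, real_inner_comm a b, real_inner_comm a c, real_inner_comm b c] at h0
  nlinarith [h0]

/-- **Case `(0,·,·)`: `E ≥ sol₀ + 0.5`** for a triangle with three long edges
(`⟪·,·⟫ ∈ [−1/2, κ₀]`) whose sum of edge-cosines is `> −3/4` (on every Delaunay triangle it is
`> −3/8`, `sum_inner_ge_of_common_cap`) — sharper than the printed `d₃(0,3,0) = 0.437`.  The
extra hypothesis only removes the degenerate corner `(−1/2, −1/2, −1/2)` of the box (three
coplanar directions); on the three sub-boxes `[−1/4, κ₀] × [−1/2, κ₀]²`,
`[−1/2,−1/4] × [−1/4, κ₀] × [−1/2, κ₀]`, `[−1/2,−1/4]² × [−1/4, κ₀]` covering the rest, the least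
corner value is `F(κ₀, κ₀, κ₀) ≈ 0.5071 ≥ 0.506 ≥ 1 − cos (sol₀ + 0.5)`.
[cite: Hales2012, Theorem 2 (d₃(0,s,t))] -/
theorem sol0_add_le_sphExcess_of_no_contact (ha : ‖a‖ = 1) (hb : ‖b‖ = 1) (hc : ‖c‖ = 1)
    (hli : LinearIndependent ℝ ![a, b, c]) (hbc : -1 / 2 ≤ ⟪b, c⟫ ∧ ⟪b, c⟫ ≤ 1031 / 5000)
    (hac : -1 / 2 ≤ ⟪a, c⟫ ∧ ⟪a, c⟫ ≤ 1031 / 5000) (hab : -1 / 2 ≤ ⟪a, b⟫ ∧ ⟪a, b⟫ ≤ 1031 / 5000)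
    (hsum : -3 / 4 < ⟪b, c⟫ + ⟪a, c⟫ + ⟪a, b⟫) :
    hales_sol0 + 0.5 ≤ sphExcess a b c := by
  apply le_sphExcess_of_one_sub_cos_le ha hb hc hli
    (by linarith [hales_sol0_le_pi_div_two, pi_gt_three])
  have hb := one_sub_cos_sol0_add_le (d := 0.5) (by norm_num) (by norm_num)
  refine le_trans hb (le_trans (show _ ≤ (253 / 500 : ℝ) by norm_num) ?_)
  set x := ⟪b, c⟫ with hx
  set y := ⟪a, c⟫ with hy
  set z := ⟪a, b⟫ with hz
  rcases le_or_gt (-1 / 4) x with hx4 | hx4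
  · refine le_eulerF_of_corners₃ (x₁ := -1 / 4) (x₂ := 1031 / 5000) (y₁ := -1 / 2)
      (y₂ := 1031 / 5000) (z₁ := -1 / 2) (z₂ := 1031 / 5000) (by norm_num) (by norm_num)
      (by norm_num) ⟨hx4, hbc.2⟩ hac hab ?_
    intro x' hx' y' hy' z' hz'
    simp only [Set.mem_insert_iff, Set.mem_singleton_iff] at hx' hy' hz'
    rcases hx' with rfl | rfl <;> rcases hy' with rfl | rfl <;> rcases hz' with rfl | rfl <;>
      norm_num [eulerF, eulerGram]
  rcases le_or_gt (-1 / 4) y with hy4 | hy4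
  · refine le_eulerF_of_corners₃ (x₁ := -1 / 2) (x₂ := -1 / 4) (y₁ := -1 / 4)
      (y₂ := 1031 / 5000) (z₁ := -1 / 2) (z₂ := 1031 / 5000) (by norm_num) (by norm_num)
      (by norm_num) ⟨hbc.1, hx4.le⟩ ⟨hy4, hac.2⟩ hab ?_
    intro x' hx' y' hy' z' hz'
    simp only [Set.mem_insert_iff, Set.mem_singleton_iff] at hx' hy' hz'
    rcases hx' with rfl | rfl <;> rcases hy' with rfl | rfl <;> rcases hz' with rfl | rfl <;>
      norm_num [eulerF, eulerGram]
  have hz4 : -1 / 4 ≤ z := by linarith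
  refine le_eulerF_of_corners₃ (x₁ := -1 / 2) (x₂ := -1 / 4) (y₁ := -1 / 2) (y₂ := -1 / 4)
    (z₁ := -1 / 4) (z₂ := 1031 / 5000) (by norm_num) (by norm_num) (by norm_num)
    ⟨hbc.1, hx4.le⟩ ⟨hac.1, hy4.le⟩ ⟨hz4, hab.2⟩ ?_
  intro x' hx' y' hy' z' hz'
  simp only [Set.mem_insert_iff, Set.mem_singleton_iff] at hx' hy' hz'
  rcases hx' with rfl | rfl <;> rcases hy' with rfl | rfl <;> rcases hz' with rfl | rfl <;>
    norm_num [eulerF, eulerGram]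

/-- **Case `(0,·,·)` with a very long edge: `E ≥ sol₀ + 0.63`** if in addition `⟪b, c⟫ ≤ 0`
(least corner value `F(0, κ₀, κ₀) ≈ 0.6289 ≥ 0.627 ≥ 1 − cos (sol₀ + 0.63)`, same sub-boxes
with `κ₀` replaced by `0` in the first coordinate). [cite: Hales2012, Theorem 2 (d₃(0,s,t))] -/
theorem sol0_add_le_sphExcess_of_no_contact_of_nonpos (ha : ‖a‖ = 1) (hb : ‖b‖ = 1)
    (hc : ‖c‖ = 1) (hli : LinearIndependent ℝ ![a, b, c]) (hbc : -1 / 2 ≤ ⟪b, c⟫ ∧ ⟪b, c⟫ ≤ 0)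
    (hac : -1 / 2 ≤ ⟪a, c⟫ ∧ ⟪a, c⟫ ≤ 1031 / 5000) (hab : -1 / 2 ≤ ⟪a, b⟫ ∧ ⟪a, b⟫ ≤ 1031 / 5000)
    (hsum : -3 / 4 < ⟪b, c⟫ + ⟪a, c⟫ + ⟪a, b⟫) :
    hales_sol0 + 0.63 ≤ sphExcess a b c := by
  apply le_sphExcess_of_one_sub_cos_le ha hb hc hli
    (by linarith [hales_sol0_le_pi_div_two, pi_gt_three])
  have hb := one_sub_cos_sol0_add_le (d := 0.63) (by norm_num) (by norm_num)
  refine le_trans hb (le_trans (show _ ≤ (627 / 1000 : ℝ) by norm_num) ?_)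
  set x := ⟪b, c⟫ with hx
  set y := ⟪a, c⟫ with hy
  set z := ⟪a, b⟫ with hz
  rcases le_or_gt (-1 / 4) x with hx4 | hx4
  · refine le_eulerF_of_corners₃ (x₁ := -1 / 4) (x₂ := 0) (y₁ := -1 / 2)
      (y₂ := 1031 / 5000) (z₁ := -1 / 2) (z₂ := 1031 / 5000) (by norm_num) (by norm_num)
      (by norm_num) ⟨hx4, hbc.2⟩ hac hab ?_
    intro x' hx' y' hy' z' hz'
    simp only [Set.mem_insert_iff, Set.mem_singleton_iff] at hx' hy' hz'
    rcases hx' with rfl | rfl <;> rcases hy' with rfl | rfl <;> rcases hz' with rfl | rfl <;>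
      norm_num [eulerF, eulerGram]
  rcases le_or_gt (-1 / 4) y with hy4 | hy4
  · refine le_eulerF_of_corners₃ (x₁ := -1 / 2) (x₂ := -1 / 4) (y₁ := -1 / 4)
      (y₂ := 1031 / 5000) (z₁ := -1 / 2) (z₂ := 1031 / 5000) (by norm_num) (by norm_num)
      (by norm_num) ⟨hbc.1, hx4.le⟩ ⟨hy4, hac.2⟩ hab ?_
    intro x' hx' y' hy' z' hz'
    simp only [Set.mem_insert_iff, Set.mem_singleton_iff] at hx' hy' hz'
    rcases hx' with rfl | rfl <;> rcases hy' with rfl | rfl <;> rcases hz' with rfl | rfl <;>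
      norm_num [eulerF, eulerGram]
  have hz4 : -1 / 4 ≤ z := by linarith
  refine le_eulerF_of_corners₃ (x₁ := -1 / 2) (x₂ := -1 / 4) (y₁ := -1 / 2) (y₂ := -1 / 4)
    (z₁ := -1 / 4) (z₂ := 1031 / 5000) (by norm_num) (by norm_num) (by norm_num)
    ⟨hbc.1, hx4.le⟩ ⟨hac.1, hy4.le⟩ ⟨hz4, hab.2⟩ ?_
  intro x' hx' y' hy' z' hz'
  simp only [Set.mem_insert_iff, Set.mem_singleton_iff] at hx' hy' hz'
  rcases hx' with rfl | rfl <;> rcases hy' with rfl | rfl <;> rcases hz' with rfl | rfl <;>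
    norm_num [eulerF, eulerGram]

end Estimates

end Literature.Geometry.DiscreteGeometry

end
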